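import Literature.NumberTheory.Automorphic.Liu2021.AppendixC.Glue
import Literature.AlgebraicGeometry.Motives.GeneratesHomExtReduced
import Literature.AlgebraicGeometry.Motives.GoodReductionSpreadingOutOfProjective
import Literature.NumberTheory.DiophantineGeometry.AbelianSchemeModelNeronExtension
import HarnessLib

/-!
# The Néron package of the Albanese difference morphism of a smooth projective curve at almost all places
# ([Liu2021] Def. 2.3 / §4.2; [BLRNeronModels1990] §1.2 Prop. 8; spreading out)

Topic `Literature/NumberTheory/Automorphic/Liu2021/AppendixC`, namespace `Literature.NumberTheory.Automorphic.Liu2021.AppendixC.Albanese`.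
THEOREMS ONLY (no definition, no named fact, no instance, no `sorry`).  Cell `hodgecm-mathlib` (D-0151), FLOOR 0, programme F0P5a (D9op
road 2′, crux item stmt-HodgeConjecture-24832, line `Cruxes/HLiu418/Lines/F0_D9opRoad2.lean`): the ∃-PREFIX of the pole letter
`RecordCurveEichlerShimuraPointwise` (A-p05 (g15) ed. 3 rf v6 :187) assembled from ★ generic pieces, for ANY smooth projective «curve-like»
`X` (smooth of relative dimension `1`, projective) over a number field `F` with ANY Albanese datum `aX : Albanese X` ([Liu2021] Def. 2.3):

* `exists_finite_forall_neronPackage` — for all finite places `w` of `F` outside a finite set there are: an abelian-scheme model `𝒜` of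
  `Alb_X` at `w` (`IsAbelianSchemeModel`, ★ `exists_finite_forall_exists_isAbelianSchemeModel`, [SerreTate1968GoodReduction] §1), a smooth proper
  model `𝒮` of `X` over `𝓞_{F,(w)}` (★ `exists_finite_forall_exists_integralModel_of_isProjectiveOver` — spreading out WITHOUT geometric
  irreducibility), an `F`-morphism `αd : X ⊗ X ⟶ Alb_X` restricting to the Albanese morphism `α_X` on the open-and-closed `∇X ⊆ X ⊗ X`
  (★ `exists_desc_eq_one_of_isClopen`), and an `𝓞_{F,(w)}`-morphism `𝔞 : 𝒮 ⊗ 𝒮 ⟶ 𝒜` whose generic fibre, read through the tensorator `μ` of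
  the generic-fibre functor, `𝒮.genericIso` and the model's chosen `e = h.exists_iso.choose`, is `αd` (★ `IsAbelianSchemeModel.exists_tensor_genericFibre_map_eq`,
  the Néron mapping property [BLRNeronModels1990] §1.2 Prop. 8).

Nothing specific to Shimura curves is used; the consumer instantiates `X := M⋆_K`, `aX := (C.alb K)`.  HC_CM is proved only modulo the 7 printed
citations until rung 0 closes; this file is a generic leaf and changes no count.

## References
* [Liu2021] Y. Liu, *Fourier–Jacobi cycles and arithmetic relative trace formula*, Camb. J. Math. 9 (2021), Def. 2.1 (1), Def. 2.3 (FJcycle.tex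
  l. 1174–1208), §4.2 l. 2066–2070.
* [BLRNeronModels1990] S. Bosch, W. Lütkebohmert, M. Raynaud, *Néron Models* (1990), §1.2 Def. 1, Prop. 8.
* [SerreTate1968GoodReduction] J.-P. Serre, J. Tate, *Good reduction of abelian varieties*, Ann. of Math. 88 (1968), §1.
-/

set_option autoImplicit false

noncomputable section

open CategoryTheory CategoryTheory.Limits AlgebraicGeometry MonoidalCategory IsDedekindDomain IsDedekindDomain.HeightOneSpectrum
open scoped MonObj NumberField CategoryTheory.Obj
open Literature.AlgebraicGeometry.Motives (AbelianVariety SchemeOver IntegralModel IsProjectiveOver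
  exists_desc_eq_one_of_isClopen exists_finite_forall_exists_integralModel_of_isProjectiveOver)
open Literature.AlgebraicGeometry.Motives.AbelianVariety (exists_finite_forall_exists_isAbelianSchemeModel)
open Literature.NumberTheory.DiophantineGeometry (IsAbelianSchemeModel)
open Literature.NumberTheory.EllipticCurves (genericFibre)

namespace Literature.NumberTheory.Automorphic.Liu2021.AppendixC

namespace Albanese

variable {F : Type} [Field F] [NumberField F]

/-- **The clopen extension `αd` of the Albanese morphism.**  For any Albanese datum `aX` of a `k`-scheme `X` there is `αd : X ⊗ X ⟶ Alb_X` with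
`∇X ↪ X ⊗ X` followed by `αd` equal to `α_X` (and `αd = 1` off `∇X`): ★ `exists_desc_eq_one_of_isClopen` at the open-and-closed immersion
`aX.nabla.incl` ([Liu2021] Def. 2.1 (1): `∇X` is open and closed in `X × X`). [cite: Liu2021, Def. 2.1 (1) and Def. 2.3 (FJcycle.tex l. 1174–1208)] -/
theorem exists_albDiff {k : Type} [Field k] {X : SchemeOver k} (aX : Albanese X) :
    ∃ αd : X ⊗ X ⟶ aX.Alb.X, aX.nabla.incl ≫ αd = aX.α := by
  haveI := aX.nabla.isOpenImmersion_incl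
  haveI := aX.nabla.isClosedImmersion_incl
  obtain ⟨αd, h, -⟩ := exists_desc_eq_one_of_isClopen aX.nabla.incl (G := aX.Alb.X) aX.α
  exact ⟨αd, h⟩

/-- **The Néron package at almost all places.**  Let `X` be a `F`-scheme smooth of relative dimension `1` and projective over the number field `F`,
with an Albanese datum `aX`.  For all finite places `w` outside a finite set there exist an abelian-scheme model `𝒜` of `Alb_X` at `w`, a smooth proper
model `𝒮` of `X` over `𝓞_{F,(w)}`, the clopen extension `αd` of `α_X`, and its NÉRON EXTENSION `𝔞 : 𝒮 ⊗ 𝒮 ⟶ 𝒜` with prescribed generic fibre —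
exactly the ∃-prefix of the F0P5a pole letter `RecordCurveEichlerShimuraPointwise`.  Assembled from ★ `exists_finite_forall_exists_isAbelianSchemeModel`,
★ `exists_finite_forall_exists_integralModel_of_isProjectiveOver`, `exists_albDiff` and ★ `IsAbelianSchemeModel.exists_tensor_genericFibre_map_eq`.
[cite: BLRNeronModels1990, §1.2 Def. 1 and Prop. 8] [cite: SerreTate1968GoodReduction, §1] [cite: Liu2021, Def. 2.3 (FJcycle.tex l. 1202–1208) and §4.2 l. 2066–2070] -/
theorem exists_finite_forall_neronPackage (X : SchemeOver F) [SmoothOfRelativeDimension 1 X.hom] (hX : IsProjectiveOver X)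
    (aX : Albanese X) :
    ∃ S₃ : Set (HeightOneSpectrum (𝓞 F)), S₃.Finite ∧ ∀ w : HeightOneSpectrum (𝓞 F), w ∉ S₃ →
      ∃ (𝒜 : SchemeOver (valuationSubringAtPrime F w)) (_ : GrpObj 𝒜) (h : IsAbelianSchemeModel aX.Alb w 𝒜)
        (𝒮 : IntegralModel (valuationSubringAtPrime F w) F X) (_ : 𝒮.IsSmoothProper 1)
        (αd : X ⊗ X ⟶ aX.Alb.X) (_ : aX.nabla.incl ≫ αd = aX.α)
        (𝔞 : 𝒮.total ⊗ 𝒮.total ⟶ 𝒜),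
        Functor.LaxMonoidal.μ (genericFibre (valuationSubringAtPrime F w) F) 𝒮.total 𝒮.total
            ≫ (genericFibre (valuationSubringAtPrime F w) F).map 𝔞 ≫ h.exists_iso.choose.hom
          = (𝒮.genericIso.hom ⊗ₘ 𝒮.genericIso.hom) ≫ αd := by
  obtain ⟨S₁, hS₁, h₁⟩ := exists_finite_forall_exists_isAbelianSchemeModel aX.Alb
  obtain ⟨S₂, hS₂, h₂⟩ := exists_finite_forall_exists_integralModel_of_isProjectiveOver (A := 𝓞 F) (n := 1) hX
  obtain ⟨αd, hαd⟩ := exists_albDiff aX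
  refine ⟨S₁ ∪ S₂, hS₁.union hS₂, fun w hw => ?_⟩
  obtain ⟨𝒜, inst, h⟩ := h₁ w (fun h' => hw (Or.inl h'))
  obtain ⟨𝒮, h𝒮⟩ := h₂ w (fun h' => hw (Or.inr h'))
  obtain ⟨𝔞, h𝔞⟩ := h.exists_tensor_genericFibre_map_eq 𝒮 h𝒮 αd h.exists_iso.choose
  exact ⟨𝒜, inst, h, 𝒮, h𝒮, αd, hαd, 𝔞, h𝔞⟩

end Albanese

end Literature.NumberTheory.Automorphic.Liu2021.AppendixC

end
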